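import Summits.Schanuel.Schanuel.Theorems.ZilberEacFermatDensity
import Summits.Schanuel.Schanuel.Theorems.ZilberEacFermatCase
import HarnessLib

/-!
# The Fermat surfaces: a certified instance of the repaired density question, answered YES

Zilber's Exponential-Algebraic Closedness, case ladder (host summit Schanuel, cell `pub-schanuel`,
seat 2, gen 5).  Conjunction of `ZilberEacFermatDensity` (`unprojectedDense_fermatSurface`: the
exponential points of `S_N = {x₀ᴺ + x₁ᴺ = 1, y₀ + y₁ = 1}` are Zariski dense, `N ≥ 2`) with the
certificate `ZilberEacFermatCase` (`S_N` is in Mantova–Masser's case (dim-π-S-1-free) and has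
multiplicatively free torus part): `S_N` is an instance of the REPAIRED (free) form of Mantova–Masser's
density question [MantovaMasser2023, §1 Further remarks, p. 5] with answer YES — the first decided
instance in the tree whose base curve is not a graph `x₁ = p(x₀)`.

HONEST FRAMING: one explicit family of instances; the free question is OPEN; `EC(3,2)` OPEN; nothing
here bears on Schanuel's conjecture (EAC ⇏ SC).
-/

noncomputable section

open MvPolynomial
open Literature.NumberTheory.Transcendental Literature.ModelTheory.Zilber

set_option linter.dupNamespace false

namespace Summit.Schanuel.Schanuel.Theorems

/-- **The Fermat surfaces decide an instance of the repaired density question (YES).**  For `N ≥ 2`,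
`S_N = {x₀ᴺ + x₁ᴺ = 1, y₀ + y₁ = 1}` satisfies all hypotheses of Mantova–Masser's case
(dim-π-S-1-free), its torus part is multiplicatively free, and its exponential points are Zariski
dense. [cite: MantovaMasser2023, §1 Further remarks, p. 5 (example (fermat))] -/
theorem unprojectedDensityQuestion_instance_fermat {N : ℕ} (hN : 2 ≤ N) :
    MMCaseDimPiOneFree {s : Fin 2 ⊕ Fin 2 → ℂ | s (Sum.inl 0) ^ N + s (Sum.inl 1) ^ N = 1 ∧
        s (Sum.inr 0) + s (Sum.inr 1) = 1} ∧
      IsMulFree ℂ 2 ({s : Fin 2 ⊕ Fin 2 → ℂ | s (Sum.inl 0) ^ N + s (Sum.inl 1) ^ N = 1 ∧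
        s (Sum.inr 0) + s (Sum.inr 1) = 1} ∩ torusLocus ℂ 2) ∧
      UnprojectedDense {s : Fin 2 ⊕ Fin 2 → ℂ | s (Sum.inl 0) ^ N + s (Sum.inl 1) ^ N = 1 ∧
        s (Sum.inr 0) + s (Sum.inr 1) = 1} :=
  ⟨mmCase_fermatSurface N hN, isMulFree_fermatSurface N (by omega), unprojectedDense_fermatSurface hN⟩

end Summit.Schanuel.Schanuel.Theorems
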